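import Literature.ModelTheory.ExponentialFields.KhovanskiiStep
import Literature.ModelTheory.ExponentialFields.SemialgebraicCountableFibres
import Mathlib.RingTheory.Polynomial.Basic
import HarnessLib

/-!
# Khovanskii's finiteness theorem for `L_exp`-terms: uniformly many non-degenerate zeros

Topic `Literature/ModelTheory/ExponentialFields`. **Khovanskii's theorem** (A. G. Khovanskii,
*Fewnomials*, Transl. Math. Monogr. 88 (1991), Ch. I §1.1 (real exponential systems) and Ch. III
(Pfaffian chains); ICM 1983 [Khovanskii1984]) in the uniform version used by A. J. Wilkie,
*On the theory of the real exponential field*, Illinois J. Math. 33 (1989), §5, Proposition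
(p. 402), case `p = n`: for every square system `f₁(ȳ, x̄), …, fₙ(ȳ, x̄)` of terms of the
language `L = (+, ·, -, 0, 1, exp, ≤)` there is `N ∈ ℕ` such that for **every** `β̄ ∈ ℝᵐ` the
system `f(β̄, ·) = 0` has at most `N` non-degenerate zeros in `ℝⁿ`
(`RealExpModel.exists_forall_encard_realNonsingularZeroSet_le`). **Proved here** (no named
facts), by Khovanskii's induction on the number of exponential subterms of the system:

* base (`Khovanskii.exists_bound_of_expSubSys_eq_empty`): a system without exponentials is
  polynomial; its non-degenerate zeros form a semialgebraic family with discrete, hence countable,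
  fibres, uniformly finite by `IsSemialgebraic.exists_forall_encard_sumElim_le` (which rests on
  the proved Tarski–Seidenberg theorem of `TarskiSeidenbergProofs.lean`);
* step (`Khovanskii.two_mul_card_le_step`, `KhovanskiiStep.lean`): eliminating an exponential of
  maximal size bounds `2 #Z₀` by the numbers of non-degenerate zeros of the contact and sphere
  systems, which have fewer exponential subterms (`KhovanskiiSystems.lean`);
* induction (`Khovanskii.exists_bound`) and the repackaging for `realNonsingularZeroSet`.

## References

* A. G. Khovanskii, *Fewnomials*, Transl. Math. Monogr. 88, AMS (1991), Ch. I §1.1, Ch. III.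
  [Khovanskii1991]
* A. G. Khovanskii, *Fewnomials and Pfaff manifolds*, Proc. ICM Warsaw 1983, 549–564.
  [Khovanskii1984]
* A. J. Wilkie, *On the theory of the real exponential field*, Illinois J. Math. 33 (1989), §5,
  Proposition (p. 402). [Wilkie1989]
-/

noncomputable section

open FirstOrder FirstOrder.Language FirstOrder.Language.Structure
open scoped Topology

namespace Literature.ModelTheory.ExponentialFields

namespace Khovanskii

open ExpTerm RealExpModel

variable {m N : ℕ}

/-! ### Base case: systems without exponentials -/

/-- The polynomial Jacobian determinant of an exp-free square system. [folklore] -/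
def detPoly (F : Fin N → Language.orderedExpRing.Term (Fin m ⊕ Fin N)) :
    MvPolynomial (Fin m ⊕ Fin N) ℤ :=
  (Matrix.of fun r j => toPoly (termPDeriv j (F r))).det

/-- The graph `{(β, x) : x ∈ ndZeros F β}` of an exp-free square system, as a set of points of
`ℝ^{m ⊕ N}` cut out by polynomial conditions. [folklore] -/
def ndGraph (F : Fin N → Language.orderedExpRing.Term (Fin m ⊕ Fin N)) : Set (Fin m ⊕ Fin N → ℝ) :=
  {p | (∀ r, MvPolynomial.aeval p (toPoly (F r)) = 0) ∧ MvPolynomial.aeval p (detPoly F) ≠ 0}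

/-- The graph is semialgebraic (over `ℤ`). [folklore] -/
theorem isSemialgebraic_ndGraph (F : Fin N → Language.orderedExpRing.Term (Fin m ⊕ Fin N)) :
    IsSemialgebraic ℤ (ndGraph F) := by
  classical
  have e : ndGraph F = (⋂ r ∈ (Finset.univ : Finset (Fin N)),
      {p : Fin m ⊕ Fin N → ℝ | MvPolynomial.aeval p (toPoly (F r)) = 0}) ∩
        {p | MvPolynomial.aeval p (detPoly F) ≠ 0} := by
    ext p
    simp [ndGraph]
  rw [e]
  exact (IsSemialgebraic.biInter _ _ fun r _ => isSemialgebraic_setOf_eval_eq_zero _).inter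
    (isSemialgebraic_setOf_eval_ne_zero _)

/-- For an exp-free system, the fibres of the graph are the sets of non-degenerate zeros.
[folklore] -/
theorem setOf_sumElim_mem_ndGraph (F : Fin N → Language.orderedExpRing.Term (Fin m ⊕ Fin N))
    (hF : expSubSys F = ∅) (β : Fin m → ℝ) :
    {x : Fin N → ℝ | Sum.elim β x ∈ ndGraph F} = ndZeros F β := by
  classical
  have hFr : ∀ r, expSub (F r) = ∅ := fun r =>
    Finset.subset_empty.1 ((expSub_subset_expSubSys F r).trans hF.subset)
  have hFd : ∀ r j, expSub (termPDeriv j (F r)) = ∅ := fun r j =>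
    Finset.subset_empty.1 ((expSub_termPDeriv_subset j (F r)).trans (hFr r).subset)
  ext x
  simp only [Set.mem_setOf_eq, ndGraph, mem_ndZeros]
  have h1 : ∀ r, MvPolynomial.aeval (Sum.elim β x) (toPoly (F r)) = (F r).realize (Sum.elim β x) :=
    fun r => (realize_eq_aeval_toPoly (F r) (hFr r) _).symm
  have h2 : MvPolynomial.aeval (Sum.elim β x) (detPoly F) = (Matrix.of fun r => grad (F r) β x).det := by
    rw [detPoly, AlgHom.map_det]
    congr 1
    ext r j
    simp only [AlgHom.mapMatrix_apply, Matrix.map_apply, Matrix.of_apply, grad_apply]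
    exact (realize_eq_aeval_toPoly _ (hFd r j) _).symm
  simp only [h1, h2]

/-- Non-degenerate zeros are isolated among the zeros, hence form a countable set. [folklore] -/
theorem countable_ndZeros (F : Fin N → Language.orderedExpRing.Term (Fin m ⊕ Fin N)) (β : Fin m → ℝ) :
    (ndZeros F β).Countable := by
  refine countable_of_forall_exists_nhds_inter_subset fun x hx => ?_
  have hx' : x ∈ realNonsingularZeroSet F β := by rwa [← ndZeros_eq_realNonsingularZeroSet]
  obtain ⟨U, hU, hUsub⟩ := exists_nhds_inter_subset_singleton F β hx'
  exact ⟨U, hU, fun y hy => hUsub ⟨hy.1, hy.2.1⟩⟩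

/-- **Base case**: an exp-free square system has uniformly finitely many non-degenerate zeros.
[cite: Khovanskii1991, Ch. I §1.1] -/
theorem exists_bound_of_expSubSys_eq_empty (F : Fin N → Language.orderedExpRing.Term (Fin m ⊕ Fin N))
    (hF : expSubSys F = ∅) : ∃ C : ℕ, ∀ β : Fin m → ℝ, (ndZeros F β).encard ≤ C := by
  obtain ⟨B, hB⟩ := (isSemialgebraic_ndGraph F).exists_forall_encard_sumElim_le
  refine ⟨B, fun β => ?_⟩
  have h := hB β
  rw [setOf_sumElim_mem_ndGraph F hF β] at h
  exact h (countable_ndZeros F β)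

/-! ### The induction -/

/-- From a bound on all finite subsets to a bound on `encard`. [folklore] -/
theorem encard_le_of_forall_finset {α : Type*} {S : Set α} {C : ℕ}
    (h : ∀ Z₀ : Finset α, (∀ x ∈ Z₀, x ∈ S) → Z₀.card ≤ C) : S.encard ≤ C := by
  classical
  by_contra hlt
  rw [not_le] at hlt
  have hle : ((C + 1 : ℕ) : ℕ∞) ≤ S.encard := by
    rw [Nat.cast_add_one]
    exact Order.add_one_le_of_lt hlt
  obtain ⟨t, htS, ht⟩ := Set.exists_subset_encard_eq hle
  have htfin : t.Finite := Set.finite_of_encard_le_coe ht.le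
  have hcard := h htfin.toFinset fun x hx => htS (htfin.mem_toFinset.1 hx)
  have : (htfin.toFinset.card : ℕ∞) = (C + 1 : ℕ) := by
    rw [← ht, htfin.encard_eq_coe_toFinset_card]
  have h2 : htfin.toFinset.card = C + 1 := by exact_mod_cast this
  omega

/-- **Khovanskii's induction**: a square system of `L_exp`-terms with at most `k` exponential
subterms has uniformly finitely many non-degenerate zeros. [cite: Khovanskii1991, Ch. III] -/
theorem exists_bound : ∀ (k : ℕ) (m N : ℕ)
    (F : Fin N → Language.orderedExpRing.Term (Fin m ⊕ Fin N)), (expSubSys F).card ≤ k →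
      ∃ C : ℕ, ∀ β : Fin m → ℝ, (ndZeros F β).encard ≤ C := by
  intro k
  induction k with
  | zero =>
    intro m N F hk
    exact exists_bound_of_expSubSys_eq_empty F (Finset.card_eq_zero.1 (Nat.le_zero.1 hk))
  | succ k ih =>
    intro m N F hk
    by_cases hle : (expSubSys F).card ≤ k
    · exact ih m N F hle
    -- an exponential subterm of maximal size
    have hne : (expSubSys F).Nonempty := by
      rw [Finset.nonempty_iff_ne_empty]
      intro h0
      rw [h0, Finset.card_empty] at hle
      exact hle (Nat.zero_le k)
    obtain ⟨e, he, hmax⟩ := Finset.exists_max_image (expSubSys F) tsize hne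
    have he' := he
    rw [expSubSys, Finset.mem_biUnion] at he'
    obtain ⟨r₀, -, hr₀⟩ := he'
    obtain ⟨es, rfl⟩ := exists_eq_exp_of_mem_expSub hr₀
    -- the auxiliary systems have at most `k` exponential subterms
    have h1 : (expSubSys (contactSys (elimF F (func expRingFunc.exp es)) (es 0))).card ≤ k :=
      Nat.lt_succ_iff.1 ((card_expSubSys_contactSys_lt F es he hmax).trans_le hk)
    have h2 : (expSubSys (sphereSys (elimF F (func expRingFunc.exp es)))).card ≤ k :=
      Nat.lt_succ_iff.1 ((card_expSubSys_sphereSys_lt F es he hmax).trans_le hk)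
    obtain ⟨C₁, hC₁⟩ := ih (m + 1) (N + 2) _ h1
    obtain ⟨C₂, hC₂⟩ := ih (m + 1) (N + 2) _ h2
    refine ⟨C₁ + C₂, fun β => encard_le_of_forall_finset fun Z₀ hZ₀ => ?_⟩
    obtain ⟨δ, R, hstep⟩ := two_mul_card_le_step F es β Z₀ hZ₀
    have h3 := hC₁ (Fin.snoc β δ)
    have h4 := hC₂ (Fin.snoc β R)
    have h5 : 2 * (Z₀.card : ℕ∞) ≤ 2 * (C₁ : ℕ∞) + C₂ := hstep.trans (by gcongr)
    have h6 : 2 * Z₀.card ≤ 2 * C₁ + C₂ := by exact_mod_cast h5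
    omega

/-- **Khovanskii's finiteness theorem, zero-counting form, for square systems of
`L_exp`-terms**: uniformly in the parameters, the number of non-degenerate zeros is bounded.
[cite: Khovanskii1991, Ch. III] [cite: Wilkie1989, §5, Proposition, p. 402] -/
theorem exists_forall_encard_ndZeros_le (F : Fin N → Language.orderedExpRing.Term (Fin m ⊕ Fin N)) :
    ∃ C : ℕ, ∀ β : Fin m → ℝ, (ndZeros F β).encard ≤ C :=
  exists_bound _ m N F le_rfl

end Khovanskii

namespace RealExpModel

/-- **Wilkie's Proposition (§5), case `p = n`, proved**: for a square system of terms
`f₁(ȳ, x̄), …, fₙ(ȳ, x̄)` of `L` there is `N ∈ ℕ` such that for every `β̄ ∈ ℝᵐ` the non-singular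
zero set `Vⁿˢ(f₁(β̄, ·), …, fₙ(β̄, ·)) ⊆ ℝⁿ` has at most `N` points (Khovanskii's theorem).
[cite: Wilkie1989, §5, Proposition, p. 402] [cite: Khovanskii1991, Ch. III] -/
theorem exists_forall_encard_realNonsingularZeroSet_le {m n : ℕ}
    (f : Fin n → Language.orderedExpRing.Term (Fin m ⊕ Fin n)) :
    ∃ N : ℕ, ∀ β : Fin m → ℝ, (realNonsingularZeroSet f β).encard ≤ N := by
  obtain ⟨C, hC⟩ := Khovanskii.exists_forall_encard_ndZeros_le f
  exact ⟨C, fun β => by rw [← Khovanskii.ndZeros_eq_realNonsingularZeroSet]; exact hC β⟩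

end RealExpModel

end Literature.ModelTheory.ExponentialFields
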